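import Literature.NumberTheory.Transcendental.ZilberQuasiminimalProofs
import Literature.NumberTheory.Transcendental.GammaPointsDense
import HarnessLib

/-!
# Bays–Kirby 2018, Thm 1.5: reduction to Prop. 11.5 and Prop. 11.2

With the density form of Γ-closedness proved (`GammaPointsDense.lean`:
`Literature.NumberTheory.Transcendental.BaysKirby2018_gammaPoints_dense_of_isExpAlgClosed_holds`, the Rabinowitsch trick of the
remark after Def. 10.3) and Ax's theorem proved in the tree, the target fact
`Literature.NumberTheory.Transcendental.isQuasiminimal_of_isExpAlgClosed` (Bays–Kirby 2018, Thm 1.5) and Cor. 11.7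
(exponential case) now rest on exactly two named facts of `ZilberGenericClosedness.lean`:

* `Literature.NumberTheory.Transcendental.BaysKirby2018_prop_11_5` — Prop. 11.5 (GΓC ⟹ GSΓC over `K`; weak Zilber–Pink);
* `Literature.NumberTheory.Transcendental.BaysKirby2018_prop_11_2` — Prop. 11.2 with Def. 5.14 (GSΓC over `K` ⟹ `ℵ₀`-saturation
  for Γ-algebraic extensions purely Γ-transcendental over `K`; good bases, Kummer theory).

## References

* M. Bays, J. Kirby, *Pseudo-exponential maps, variants, and quasiminimality*, Algebra & Number
  Theory 12 (2018) 493–549, Thm 1.5, Prop. 11.2, Prop. 11.5, Cor. 11.7.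
-/

namespace Literature.NumberTheory.Transcendental

/-- **Bays–Kirby 2018, Cor. 11.7 (exponential case) from Prop. 11.5 + Prop. 11.2.**
[cite: BaysKirby2018ANT, Cor. 11.7, Prop. 11.5, Prop. 11.2] -/
theorem BaysKirby2018_isQuasiminimal_of_isExpAlgClosed_of_ccp_of_props
    (h5 : BaysKirby2018_prop_11_5.{0}) (h2 : BaysKirby2018_prop_11_2.{0}) :
    BaysKirby2018_isQuasiminimal_of_isExpAlgClosed_of_ccp.{0} :=
  BaysKirby2018_isQuasiminimal_of_isExpAlgClosed_of_ccp_of_saturation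
    (BaysKirby2018_saturation_of_isExpAlgClosed_of_props h5 h2)

/-- **Bays–Kirby 2018, Thm 1.5 from Prop. 11.5 + Prop. 11.2**: if `ℂ_exp` is
exponentially-algebraically closed then it is quasiminimal, granted the two named facts.
[cite: BaysKirby2018ANT, Thm 1.5, Prop. 11.5, Prop. 11.2] -/
theorem isQuasiminimal_of_isExpAlgClosed_of_props
    (h5 : BaysKirby2018_prop_11_5.{0}) (h2 : BaysKirby2018_prop_11_2.{0}) :
    Transcendental.isQuasiminimal_of_isExpAlgClosed :=
  Transcendental.isQuasiminimal_of_isExpAlgClosed_of_saturation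
    (BaysKirby2018_saturation_of_isExpAlgClosed_of_props h5 h2)

end Literature.NumberTheory.Transcendental
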